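import Mathlib
import HarnessLib
import Summits.Ventures.LatticeQCDFlow.Exactness.NCMCGeneralSpaceReplicaTStatisticCoverage
import Summits.Ventures.LatticeQCDFlow.Exactness.NCMCGeneralSpaceDeltaMethod
import Summits.Ventures.LatticeQCDFlow.Scoring.MultivariateDeltaMethod

/-!
# The delete-one-block JACKKNIFE of a POOLED NONLINEAR statistic (`free_energy`'s `dF ± dF_err`, `dF_biascorr`) has the replica-`t` limiting coverage `L_R(q)`

HONEST FRAMING: exact (Metropolis-corrected) sampling algorithms for lattice gauge theory;
figures of merit are autocorrelation/cost numbers at stated couplings and volumes; no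
continuum-physics claim.

Venture `LatticeQCDFlow` (cell pub-lqcd), topic `Exactness`; FANOUT row 13 (`eng-snf`, GEN-25).
NEW WORK of the cell (elementary asymptotic statistics) against Mathlib (Slutsky
`TendstoInDistribution.prodMk_of_tendstoInMeasure_const`, `sub_smul_dslope`, portmanteau), the
cell's `NCMCGeneralSpaceReplicaTStatistic{,Coverage}` (a.e.-continuous mapping, null diagonal,
atomless law of `t(Z)`), `NCMCGeneralSpaceDeltaMethod` (`measurable_dslope`) and row 4's
`Scoring/MultivariateDeltaMethod` (`tendstoInMeasure_of_tendstoInDistribution_smul`); not a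
published result; no definition; nothing cited as a fact (jackknife / delta method NAMED ONLY).

WHY (row 13).  `latflow-snf`'s `estimators.free_energy` prints `dF = φ(ᾱ)`, `φ = −log` of the
POOLED mean `ᾱ = (Σ_r α_r)/R` of the `R = n_blocks` block means `α_r` of `e^{−W}`, the
delete-one-block replicates `φ(ᾱ_{(−r)})`, `ᾱ_{(−r)} = (Σ_{s≠r} α_s)/(R−1)`, their mean `φ̄_{(·)}`,
`dF_err = √(((R−1)/R) Σ_r (φ(ᾱ_{(−r)}) − φ̄_{(·)})²)` and `dF_biascorr = R·φ(ᾱ) − (R−1)·φ̄_{(·)}`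
(`estimators.jackknife`, verbatim).  GEN-24 `…ReplicaJackknifeIdentity` showed that for a LINEAR
statistic this bar IS the replica-`t` bar and listed the nonlinear case as NOT CLAIMED.  Settled
here at fixed `R ≥ 2`: if the block-mean vector obeys the replica-vector CLT
`(√n (α_{r,n} − a))_r ⇒ N(0, v)^{⊗R}` (`v ≠ 0`; GEN-23/24: independent chains from any starts,
starts branched off one run, independent runs) and `φ` has derivative `c ≠ 0` at `a` (`−log` at
`a = Z₁/Z₀ > 0`), then for every `q ≥ 0` and every bias-correction weight `κ` (`κ = 0`: `dF`;
`κ = R − 1`: `dF_biascorr`) `P(|centre − φ(a)| ≤ q·dF_err) → L_R(q) = N(0,1)^{⊗R}{|t| ≤ q}` — the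
universal Student-type limit of every other bar of the engine (value: GEN-24 S/B/T/F7).
Mechanism: with `v_r = √n (α_r − a)`, EXACTLY `√n (φ(ᾱ_S) − φ(a)) = dslope φ a (ᾱ_S) · v̄_S`, so
the studentised deviation is a fixed measurable `Ψ(v, α)`; `α_n → a` in probability,
`(v_n, α_n) ⇒ (Z, a)` (Slutsky), `Ψ` is continuous at `(z, a)` off the diagonal with
`Ψ(z, a) = sign(c)·t(z)` (jackknife identity); the bias correction is `o_P(n^{−1/2})`.  Content:
**`tendsto_measure_abs_le_of_perturbed_tStat`** (§1, the reusable core), the algebra (§2),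
**`tendsto_measure_abs_pooledJackknife_le`** (§3, free `κ`) and **`…_dF`** (`κ = 0`).

NOT CLAIMED: unequal block lengths; `R → ∞` with `n`; the batch-means vector CLT for CONTIGUOUS
blocks of one chain (the hypothesis is the vector CLT itself); anything numerical.
-/

namespace Summit.Ventures.LatticeQCDFlow.Exactness.GeneralNCMC

open MeasureTheory ProbabilityTheory Filter Finset WithLp
open scoped ENNReal NNReal Topology

/-! ## §1 A perturbed replica-`t` statistic: coverage from `Ψ(V_n, Y_n)`, `Ψ(z, y₀) = ± t(z)` -/

section Perturbed

variable {ι : Type*} [Fintype ι] [Nontrivial ι]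
  {Ω₀ : Type*} [MeasurableSpace Ω₀] {P : Measure Ω₀} [IsProbabilityMeasure P]
  {E' : Type*} [NormedAddCommGroup E'] [MeasurableSpace E'] [BorelSpace E']
  [SecondCountableTopology E']

/-- **PERTURBED REPLICA-`t` COVERAGE.**  `V_n ⇒ N(0, v)^{⊗R}` in `EuclideanSpace ℝ ι` (`v ≠ 0`,
`R ≥ 2`), `Y_n → y₀` in probability (any second-countable normed group), eventually
`T_n = Ψ(V_n, Y_n)` with `Ψ` measurable and, for a.e. `z` under the product Gaussian, continuous at
`(z, y₀)` with `Ψ(z, y₀) = σ·t(z)`, `|σ| = 1` ⇒ `P(|T_n| ≤ q) → L_R(q) = N(0,1)^{⊗R}{|t| ≤ q}`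
for every `q ≥ 0` (Slutsky; a.e.-continuous mapping; the law of `t(Z)` has no atoms). -/
theorem tendsto_measure_abs_le_of_perturbed_tStat
    {V : ℕ → Ω₀ → PiLp 2 (fun _ : ι => ℝ)} {Y : ℕ → Ω₀ → E'} {y₀ : E'} {v : ℝ≥0} (hv : v ≠ 0)
    (hV : TendstoInDistribution V atTop (toLp 2) (fun _ => P)
      (Measure.pi fun _ : ι => gaussianReal 0 v))
    (hY : TendstoInMeasure P Y atTop (fun _ => y₀)) (hYm : ∀ n, AEMeasurable (Y n) P)
    {Ψ : PiLp 2 (fun _ : ι => ℝ) × E' → ℝ} (hΨm : Measurable Ψ) {σ : ℝ} (hσ : |σ| = 1)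
    (hcont : ∀ᵐ z ∂(Measure.pi fun _ : ι => gaussianReal 0 v), ContinuousAt Ψ (toLp 2 z, y₀))
    (hval : ∀ᵐ z ∂(Measure.pi fun _ : ι => gaussianReal 0 v),
      Ψ (toLp 2 z, y₀) = σ * ((∑ r, z r) / Fintype.card ι
        / Real.sqrt ((∑ r, (z r - (∑ r', z r') / Fintype.card ι) ^ 2)
            / ((Fintype.card ι : ℝ) * (Fintype.card ι - 1)))))
    {T : ℕ → Ω₀ → ℝ} (hT : ∀ᶠ n in atTop, ∀ ω, T n ω = Ψ (V n ω, Y n ω)) {q : ℝ} (hq : 0 ≤ q) :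
    Tendsto (fun n => P {ω | |T n ω| ≤ q}) atTop
      (𝓝 ((Measure.pi fun _ : ι => gaussianReal 0 1) {z : ι → ℝ | |(∑ r, z r) / Fintype.card ι
        / Real.sqrt ((∑ r, (z r - (∑ r', z r') / Fintype.card ι) ^ 2)
            / ((Fintype.card ι : ℝ) * (Fintype.card ι - 1)))| ≤ q})) := by
  set P' : Measure (ι → ℝ) := Measure.pi fun _ : ι => gaussianReal 0 v with hP'
  set t : (ι → ℝ) → ℝ := fun z => (∑ r, z r) / Fintype.card ι
        / Real.sqrt ((∑ r, (z r - (∑ r', z r') / Fintype.card ι) ^ 2)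
            / ((Fintype.card ι : ℝ) * (Fintype.card ι - 1))) with ht
  have htm : Measurable t := measurable_tStat_pi
  have hσ0 : σ ≠ 0 := fun h => by simp [h] at hσ
  -- Slutsky: the pair converges
  have hpair := hV.prodMk_of_tendstoInMeasure_const V Y (toLp 2) hY hYm
  -- a.e.-continuous mapping, then replace the limit variable by `σ · t`
  have hΨ : TendstoInDistribution (fun n ω => Ψ (V n ω, Y n ω)) atTop (fun z => σ * t z)
      (fun _ => P) P' :=
    (TendstoInDistribution.comp_of_ae_continuousAt hpair hΨm hcont).congr
      (fun n => Eventually.of_forall fun ω => rfl) hval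
  -- the limit law does not charge `{−q, q}`
  have hnull : (P'.map fun z => σ * t z) (frontier (Set.Icc (-q) q)) = 0 := by
    rw [frontier_Icc (by linarith : -q ≤ q)]
    haveI : NullSingletonClass (P'.map fun z => σ * t z) := ⟨fun x => by
      rw [Measure.map_apply (htm.const_mul σ) (measurableSet_singleton x)]
      have hset : (fun z => σ * t z) ⁻¹' {x} = {z | t z = x / σ} := by
        ext z
        simp only [Set.mem_preimage, Set.mem_singleton_iff, Set.mem_setOf_eq]
        rw [eq_div_iff hσ0, mul_comm]
      rw [hset]
      exact pi_gaussianReal_measure_tStat_eq_eq_zero 0 hv (x / σ)⟩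
    exact (Set.toFinite {-q, q}).measure_zero _
  have key := ProbabilityMeasure.tendsto_measure_of_null_frontier_of_tendsto' hΨ.tendsto
    (E := Set.Icc (-q) q) (by simpa using hnull)
  simp only [ProbabilityMeasure.coe_mk] at key
  rw [Measure.map_apply_of_aemeasurable hΨ.aemeasurable_limit measurableSet_Icc] at key
  -- the limit side is `P'{|t| ≤ q}`, which is `v`-free
  have hlim : (fun z => σ * t z) ⁻¹' Set.Icc (-q) q = {z | |t z| ≤ q} := by
    ext z
    simp only [Set.mem_preimage, Set.mem_Icc, Set.mem_setOf_eq, ← abs_le, abs_mul, hσ, one_mul]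
  rw [hlim, hP', ht] at key
  rw [← pi_gaussianReal_measure_abs_tStat_le_eq hv q]
  refine (key.congr' ?_)
  filter_upwards [hT] with n hn
  rw [Measure.map_apply_of_aemeasurable (hΨ.forall_aemeasurable n) measurableSet_Icc]
  congr 1
  ext ω
  simp only [Set.mem_preimage, Set.mem_Icc, Set.mem_setOf_eq, hn ω, abs_le]

end Perturbed

/-! ## §2 Jackknife algebra: leave-one-out means, the limit variance, the exact `√n`-scaling -/

section Algebra

variable {ι : Type*} [Fintype ι] [DecidableEq ι]

omit [Fintype ι] [DecidableEq ι] in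
/-- Scaling a mean over `S ≠ ∅`: `(Σ_{s∈S} c (α_s − a))/|S| = c ((Σ_{s∈S} α_s)/|S| − a)`. -/
theorem sum_mul_sub_div_card (S : Finset ι) (hS : (S.card : ℝ) ≠ 0) (α : ι → ℝ) (c a : ℝ) :
    (∑ s ∈ S, c * (α s - a)) / S.card = c * ((∑ s ∈ S, α s) / S.card - a) := by
  rw [← mul_sum, sum_sub_distrib, sum_const, nsmul_eq_mul]
  field_simp

/-- `card (univ.erase r) = R − 1` as reals. -/
theorem card_univ_erase_cast (r : ι) : ((univ.erase r).card : ℝ) = (Fintype.card ι : ℝ) - 1 := by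
  rw [card_erase_of_mem (mem_univ r), card_univ, Nat.cast_sub (Fintype.card_pos_iff.2 ⟨r⟩),
    Nat.cast_one]

/-- **The mean of the leave-one-out means is the mean**: `(Σ_t c ᾱ_{(−t)})/R = c ᾱ` (`R ≥ 2`). -/
theorem sum_const_mul_looMean_div (hR1 : (Fintype.card ι : ℝ) - 1 ≠ 0) (α : ι → ℝ) (c : ℝ) :
    (∑ t, c * ((∑ s ∈ univ.erase t, α s) / ((Fintype.card ι : ℝ) - 1))) / Fintype.card ι
      = c * ((∑ s, α s) / Fintype.card ι) := by
  simp_rw [sum_erase_eq_sub (mem_univ _)]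
  rw [← mul_sum, ← sum_div, sum_sub_distrib, sum_const, card_univ, nsmul_eq_mul]
  field_simp

/-- **THE JACKKNIFE VARIANCE AT THE LIMIT**: for `R = card ι ≥ 2` and any `c`,
`((R−1)/R) Σ_r (c ᾱ_{(−r)} − (Σ_t c ᾱ_{(−t)})/R)² = c² · (Σ_r (α_r − ᾱ)²)/(R(R−1))` — the
delete-one variance of the linearised replicates is `c²` times the replica-`t` variance. -/
theorem jackknife_variance_const_mul_looMean (hR0 : (Fintype.card ι : ℝ) ≠ 0)
    (hR1 : (Fintype.card ι : ℝ) - 1 ≠ 0) (α : ι → ℝ) (c : ℝ) :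
    ((Fintype.card ι : ℝ) - 1) / Fintype.card ι
        * ∑ r, (c * ((∑ s ∈ univ.erase r, α s) / ((Fintype.card ι : ℝ) - 1))
            - (∑ t, c * ((∑ s ∈ univ.erase t, α s) / ((Fintype.card ι : ℝ) - 1)))
                / Fintype.card ι) ^ 2
      = c ^ 2 * ((∑ r, (α r - (∑ s, α s) / Fintype.card ι) ^ 2)
          / ((Fintype.card ι : ℝ) * (Fintype.card ι - 1))) := by
  rw [sum_const_mul_looMean_div hR1 α c]
  simp_rw [sum_erase_eq_sub (mem_univ _)]
  have hterm : ∀ r, (c * (((∑ s, α s) - α r) / ((Fintype.card ι : ℝ) - 1))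
      - c * ((∑ s, α s) / Fintype.card ι)) ^ 2
        = c ^ 2 / ((Fintype.card ι : ℝ) - 1) ^ 2 * (α r - (∑ s, α s) / Fintype.card ι) ^ 2 :=
    fun r => by field_simp; ring
  simp_rw [hterm]
  rw [← mul_sum]
  field_simp

omit [DecidableEq ι] in
/-- **Scale invariance of a studentised, bias-corrected deviation**: multiplying every
`G_r − f₀` and `F − f₀` by the same `s > 0` does not change
`(F + κ(F − Ḡ) − f₀) / √(((R−1)/R) Σ_r (G_r − Ḡ)²)`. -/
theorem studentised_biasCorrected_scale (F f₀ κ : ℝ) (G : ι → ℝ) {s : ℝ} (hs : 0 < s) :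
    (F + κ * (F - (∑ t, G t) / Fintype.card ι) - f₀)
        / Real.sqrt (((Fintype.card ι : ℝ) - 1) / Fintype.card ι
          * ∑ r, (G r - (∑ t, G t) / Fintype.card ι) ^ 2)
      = (s * (F - f₀) + κ * (s * (F - f₀) - (∑ t, s * (G t - f₀)) / Fintype.card ι))
        / Real.sqrt (((Fintype.card ι : ℝ) - 1) / Fintype.card ι
          * ∑ r, (s * (G r - f₀) - (∑ t, s * (G t - f₀)) / Fintype.card ι) ^ 2) := by
  rcases isEmpty_or_nonempty ι with hι | hι
  · simp
  have hR0 : (Fintype.card ι : ℝ) ≠ 0 := Nat.cast_ne_zero.2 Fintype.card_ne_zero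
  have hnum : s * (F - f₀) + κ * (s * (F - f₀) - (∑ t, s * (G t - f₀)) / Fintype.card ι)
      = s * (F + κ * (F - (∑ t, G t) / Fintype.card ι) - f₀) := by
    rw [← mul_sum, sum_sub_distrib, sum_const, card_univ, nsmul_eq_mul]
    field_simp
    ring
  have hdev : ∀ r, s * (G r - f₀) - (∑ t, s * (G t - f₀)) / Fintype.card ι
      = s * (G r - (∑ t, G t) / Fintype.card ι) := fun r => by
    rw [← mul_sum, sum_sub_distrib, sum_const, card_univ, nsmul_eq_mul]
    field_simp
    ring
  simp_rw [hdev, hnum]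
  have hsq : ∀ r, (s * (G r - (∑ t, G t) / Fintype.card ι)) ^ 2
      = s ^ 2 * (G r - (∑ t, G t) / Fintype.card ι) ^ 2 := fun r => by ring
  simp_rw [hsq]
  rw [← mul_sum, mul_left_comm, Real.sqrt_mul (sq_nonneg s), Real.sqrt_sq hs.le,
    mul_div_mul_left _ _ hs.ne']

/-- **THE EXACT `√n`-SCALING IDENTITY**: for block estimates `α`, centre `a`, scale `s > 0`,
bias-correction weight `κ` and ANY `φ`, with `v_r = s (α_r − a)` and `D = dslope φ a`
(`D(x) · s (x − a) = s (φ x − φ a)` exactly), the jackknife-studentised deviation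
`(φ(ᾱ) + κ(φ(ᾱ) − φ̄_{(·)}) − φ(a)) / √(((R−1)/R) Σ_r (φ(ᾱ_{(−r)}) − φ̄_{(·)})²)` EQUALS the
scale-free expression `Ψ_κ(v, α)` in which every `φ(ᾱ_S) − φ(a)` is replaced by `D(ᾱ_S) · v̄_S`. -/
theorem jackknife_studentised_eq_scaled (hR0 : (Fintype.card ι : ℝ) ≠ 0)
    (hR1 : (Fintype.card ι : ℝ) - 1 ≠ 0) (φ : ℝ → ℝ) (α : ι → ℝ) (a κ : ℝ) {s : ℝ} (hs : 0 < s) :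
    (φ ((∑ r, α r) / Fintype.card ι)
        + κ * (φ ((∑ r, α r) / Fintype.card ι)
          - (∑ t, φ ((∑ r ∈ univ.erase t, α r) / ((Fintype.card ι : ℝ) - 1))) / Fintype.card ι)
        - φ a)
      / Real.sqrt (((Fintype.card ι : ℝ) - 1) / Fintype.card ι
        * ∑ r, (φ ((∑ u ∈ univ.erase r, α u) / ((Fintype.card ι : ℝ) - 1))
          - (∑ t, φ ((∑ u ∈ univ.erase t, α u) / ((Fintype.card ι : ℝ) - 1)))
              / Fintype.card ι) ^ 2)
    = (dslope φ a ((∑ r, α r) / Fintype.card ι) * ((∑ r, s * (α r - a)) / Fintype.card ι)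
        + κ * (dslope φ a ((∑ r, α r) / Fintype.card ι) * ((∑ r, s * (α r - a)) / Fintype.card ι)
          - (∑ t, dslope φ a ((∑ r ∈ univ.erase t, α r) / ((Fintype.card ι : ℝ) - 1))
              * ((∑ r ∈ univ.erase t, s * (α r - a)) / ((Fintype.card ι : ℝ) - 1)))
                / Fintype.card ι))
      / Real.sqrt (((Fintype.card ι : ℝ) - 1) / Fintype.card ι
        * ∑ r, (dslope φ a ((∑ u ∈ univ.erase r, α u) / ((Fintype.card ι : ℝ) - 1))
              * ((∑ u ∈ univ.erase r, s * (α u - a)) / ((Fintype.card ι : ℝ) - 1))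
          - (∑ t, dslope φ a ((∑ u ∈ univ.erase t, α u) / ((Fintype.card ι : ℝ) - 1))
              * ((∑ u ∈ univ.erase t, s * (α u - a)) / ((Fintype.card ι : ℝ) - 1)))
                / Fintype.card ι) ^ 2) := by
  -- the exact linearisation `D(x) · s(x − a) = s (φ x − φ a)`
  have hlin : ∀ x, dslope φ a x * (s * (x - a)) = s * (φ x - φ a) := fun x => by
    rw [← sub_smul_dslope φ a x, smul_eq_mul]; ring
  have hfull : (∑ r, s * (α r - a)) / (Fintype.card ι : ℝ)
      = s * ((∑ r, α r) / Fintype.card ι - a) := by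
    simpa only [card_univ] using sum_mul_sub_div_card (univ : Finset ι) (by rwa [card_univ]) α s a
  have hloo : ∀ t, (∑ r ∈ univ.erase t, s * (α r - a)) / ((Fintype.card ι : ℝ) - 1)
      = s * ((∑ r ∈ univ.erase t, α r) / ((Fintype.card ι : ℝ) - 1) - a) := fun t => by
    simpa only [card_univ_erase_cast] using
      sum_mul_sub_div_card (univ.erase t) (by rw [card_univ_erase_cast]; exact hR1) α s a
  simp_rw [hfull, hloo, hlin]
  exact studentised_biasCorrected_scale _ _ _ _ hs

end Algebra

/-! ## §3 The delete-one-block jackknife bar of `φ(pooled mean)` has limiting coverage `L_R(q)` -/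

section Main

variable {ι : Type*} [Fintype ι] [DecidableEq ι] [Nontrivial ι]
  {Ω₀ : Type*} [MeasurableSpace Ω₀] {P : Measure Ω₀} [IsProbabilityMeasure P]

/-- **THE POOLED NONLINEAR JACKKNIFE BAR COVERS WITH PROBABILITY `→ L_R(q)`** (free
bias-correction weight `κ`; `κ = R − 1` is `dF_biascorr`).  Block estimates `A_n : Ω → (ι → ℝ)`
(`R = card ι ≥ 2`), a centre `a`, a measurable `φ` with derivative `c ≠ 0` at `a`, the
replica-vector CLT `(√n (A_{n,r} − a))_r ⇒ N(0, v)^{⊗R}` (`v ≠ 0`): for every `κ` and `q ≥ 0`,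
`P(|φ(Ā_n) + κ(φ(Ā_n) − φ̄_{(·),n}) − φ(a)| ≤ q·√(((R−1)/R) Σ_r (φ(Ā_{(−r),n}) − φ̄_{(·),n})²))`
(as the studentised ratio) `→ N(0,1)^{⊗R}{|t| ≤ q}`. -/
theorem tendsto_measure_abs_pooledJackknife_le {A : ℕ → Ω₀ → ι → ℝ} (hA : ∀ n, Measurable (A n))
    {a : ℝ} {φ : ℝ → ℝ} (hφm : Measurable φ) {c : ℝ} (hφ : HasDerivAt φ c a) (hc : c ≠ 0)
    {v : ℝ≥0} (hv : v ≠ 0)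
    (hV : TendstoInDistribution
      (fun (n : ℕ) ω => toLp 2 (fun r => Real.sqrt (n : ℝ) * (A n ω r - a)))
      atTop (toLp 2) (fun _ => P) (Measure.pi fun _ : ι => gaussianReal 0 v))
    (κ : ℝ) {q : ℝ} (hq : 0 ≤ q) :
    Tendsto (fun n => P {ω |
      |(φ ((∑ r, A n ω r) / Fintype.card ι)
          + κ * (φ ((∑ r, A n ω r) / Fintype.card ι)
            - (∑ t, φ ((∑ r ∈ univ.erase t, A n ω r) / ((Fintype.card ι : ℝ) - 1)))
                / Fintype.card ι)
          - φ a)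
        / Real.sqrt (((Fintype.card ι : ℝ) - 1) / Fintype.card ι
          * ∑ r, (φ ((∑ u ∈ univ.erase r, A n ω u) / ((Fintype.card ι : ℝ) - 1))
            - (∑ t, φ ((∑ u ∈ univ.erase t, A n ω u) / ((Fintype.card ι : ℝ) - 1)))
                / Fintype.card ι) ^ 2)| ≤ q}) atTop
      (𝓝 ((Measure.pi fun _ : ι => gaussianReal 0 1) {z : ι → ℝ | |(∑ r, z r) / Fintype.card ι
        / Real.sqrt ((∑ r, (z r - (∑ r', z r') / Fintype.card ι) ^ 2)
            / ((Fintype.card ι : ℝ) * (Fintype.card ι - 1)))| ≤ q})) := by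
  have hR2 : (2 : ℝ) ≤ Fintype.card ι := by
    exact_mod_cast (Fintype.one_lt_card : 2 ≤ Fintype.card ι)
  have hR0 : (Fintype.card ι : ℝ) ≠ 0 := by positivity
  have hR1 : (Fintype.card ι : ℝ) - 1 ≠ 0 := by linarith
  have hRpos : (0 : ℝ) < (Fintype.card ι : ℝ) * (Fintype.card ι - 1) :=
    mul_pos (by linarith) (by linarith)
  set P' : Measure (ι → ℝ) := Measure.pi fun _ : ι => gaussianReal 0 v with hP'
  -- the scale-free function of the pair (scaled deviations, block estimates)
  set Ψ : PiLp 2 (fun _ : ι => ℝ) × PiLp 2 (fun _ : ι => ℝ) → ℝ := fun p =>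
    (dslope φ a ((∑ r, p.2 r) / Fintype.card ι) * ((∑ r, p.1 r) / Fintype.card ι)
        + κ * (dslope φ a ((∑ r, p.2 r) / Fintype.card ι) * ((∑ r, p.1 r) / Fintype.card ι)
          - (∑ t, dslope φ a ((∑ r ∈ univ.erase t, p.2 r) / ((Fintype.card ι : ℝ) - 1))
              * ((∑ r ∈ univ.erase t, p.1 r) / ((Fintype.card ι : ℝ) - 1)))
                / Fintype.card ι))
      / Real.sqrt (((Fintype.card ι : ℝ) - 1) / Fintype.card ι
        * ∑ r, (dslope φ a ((∑ u ∈ univ.erase r, p.2 u) / ((Fintype.card ι : ℝ) - 1))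
              * ((∑ u ∈ univ.erase r, p.1 u) / ((Fintype.card ι : ℝ) - 1))
          - (∑ t, dslope φ a ((∑ u ∈ univ.erase t, p.2 u) / ((Fintype.card ι : ℝ) - 1))
              * ((∑ u ∈ univ.erase t, p.1 u) / ((Fintype.card ι : ℝ) - 1)))
                / Fintype.card ι) ^ 2) with hΨ
  have hD : Measurable (dslope φ a) := measurable_dslope hφm a
  have hΨm : Measurable Ψ := by rw [hΨ]; fun_prop
  -- the block estimates converge in probability to the constant vector `a` (pinned by the CLT)
  have hYm : ∀ n, AEMeasurable (fun ω => toLp 2 (A n ω) : Ω₀ → PiLp 2 (fun _ : ι => ℝ)) P :=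
    fun n => ((WithLp.measurable_toLp 2 (ι → ℝ)).comp (hA n)).aemeasurable
  have hY : TendstoInMeasure P (fun n ω => (toLp 2 (A n ω) : PiLp 2 (fun _ : ι => ℝ))) atTop
      (fun _ => toLp 2 (fun _ : ι => a)) := by
    -- `√n • (toLp α − toLp a) = toLp (√n (α − a))` definitionally, so `hV` is the premise
    exact Scoring.CardConsistency.tendstoInMeasure_of_tendstoInDistribution_smul
      (a := fun n : ℕ => Real.sqrt (n : ℝ))
      (Real.tendsto_sqrt_atTop.comp tendsto_natCast_atTop_atTop) (Z := toLp 2) (P' := P') hV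
  -- values at the limit point `(z, a)`; `Ψ(z, a) = (c/|c|) · t(z)` for EVERY `z`
  have hev : ∀ t, (∑ r ∈ univ.erase t, (toLp 2 (fun _ : ι => a) : PiLp 2 (fun _ : ι => ℝ)) r)
      / ((Fintype.card ι : ℝ) - 1) = a := fun t => by
    simp only [sum_const, card_univ_erase_cast, nsmul_eq_mul]
    field_simp
  have hevm :
      (∑ r, (toLp 2 (fun _ : ι => a) : PiLp 2 (fun _ : ι => ℝ)) r) / Fintype.card ι = a := by
    simp only [sum_const, card_univ, nsmul_eq_mul]
    field_simp
  have hDa : dslope φ a a = c := by rw [dslope_same, hφ.deriv]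
  have hDc : ContinuousAt (dslope φ a) a := continuousAt_dslope_same.2 hφ.differentiableAt
  have hval : ∀ z : ι → ℝ, Ψ (toLp 2 z, toLp 2 (fun _ : ι => a))
      = c / |c| * ((∑ r, z r) / Fintype.card ι
        / Real.sqrt ((∑ r, (z r - (∑ r', z r') / Fintype.card ι) ^ 2)
            / ((Fintype.card ι : ℝ) * (Fintype.card ι - 1)))) := by
    intro z
    simp only [hΨ, hev, hevm, hDa]
    rw [jackknife_variance_const_mul_looMean hR0 hR1 z c, sum_const_mul_looMean_div hR1 z c,
      sub_self, mul_zero, add_zero, Real.sqrt_mul (sq_nonneg c), Real.sqrt_sq_eq_abs,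
      mul_div_mul_comm]
  -- continuity of `Ψ` at `(z, a)` off the diagonal
  have hcont : ∀ᵐ z ∂P', ContinuousAt Ψ (toLp 2 z, toLp 2 (fun _ : ι => a)) := by
    filter_upwards [ae_sumSqDev_ne_zero_pi_gaussianReal (ι := ι) 0 hv] with z hz
    set p₀ : PiLp 2 (fun _ : ι => ℝ) × PiLp 2 (fun _ : ι => ℝ) :=
      (toLp 2 z, toLp 2 (fun _ : ι => a)) with hp₀
    have hm1 : Continuous fun p : PiLp 2 (fun _ : ι => ℝ) × PiLp 2 (fun _ : ι => ℝ) =>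
        (∑ r, p.1 r) / (Fintype.card ι : ℝ) := by fun_prop
    have hl1 : ∀ t, Continuous fun p : PiLp 2 (fun _ : ι => ℝ) × PiLp 2 (fun _ : ι => ℝ) =>
        (∑ r ∈ univ.erase t, p.1 r) / ((Fintype.card ι : ℝ) - 1) := fun t => by fun_prop
    have hm2 : Continuous fun p : PiLp 2 (fun _ : ι => ℝ) × PiLp 2 (fun _ : ι => ℝ) =>
        (∑ r, p.2 r) / (Fintype.card ι : ℝ) := by fun_prop
    have hl2 : ∀ t, Continuous fun p : PiLp 2 (fun _ : ι => ℝ) × PiLp 2 (fun _ : ι => ℝ) =>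
        (∑ r ∈ univ.erase t, p.2 r) / ((Fintype.card ι : ℝ) - 1) := fun t => by fun_prop
    -- `dslope φ a` composed with the (leave-one-out) means of the second component
    have hDm : ContinuousAt (fun p : PiLp 2 (fun _ : ι => ℝ) × PiLp 2 (fun _ : ι => ℝ) =>
        dslope φ a ((∑ r, p.2 r) / (Fintype.card ι : ℝ))) p₀ :=
      hDc.comp_of_eq hm2.continuousAt (by rw [hp₀]; exact hevm)
    have hDl : ∀ t, ContinuousAt (fun p : PiLp 2 (fun _ : ι => ℝ) × PiLp 2 (fun _ : ι => ℝ) =>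
        dslope φ a ((∑ r ∈ univ.erase t, p.2 r) / ((Fintype.card ι : ℝ) - 1))) p₀ :=
      fun t => hDc.comp_of_eq (hl2 t).continuousAt (by rw [hp₀]; exact hev t)
    have hS : ContinuousAt (fun p : PiLp 2 (fun _ : ι => ℝ) × PiLp 2 (fun _ : ι => ℝ) =>
        (∑ t, dslope φ a ((∑ r ∈ univ.erase t, p.2 r) / ((Fintype.card ι : ℝ) - 1))
          * ((∑ r ∈ univ.erase t, p.1 r) / ((Fintype.card ι : ℝ) - 1)))
            / (Fintype.card ι : ℝ)) p₀ :=
      (tendsto_finsetSum _ fun t _ => (hDl t).mul (hl1 t).continuousAt).div_const _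
    -- the limit variance is `c² · SSD(z)/(R(R−1)) > 0`
    have hJpos : 0 < c ^ 2 * ((∑ r, (z r - (∑ s, z s) / Fintype.card ι) ^ 2)
          / ((Fintype.card ι : ℝ) * (Fintype.card ι - 1))) :=
      mul_pos (by positivity) (div_pos (lt_of_le_of_ne (sum_nonneg fun r _ => sq_nonneg _)
        (Ne.symm hz)) hRpos)
    rw [hΨ]
    refine ((hDm.mul hm1.continuousAt).add (continuousAt_const.mul
      ((hDm.mul hm1.continuousAt).sub hS))).div
      (Real.continuous_sqrt.continuousAt.comp (continuousAt_const.mul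
        (tendsto_finsetSum _ fun r _ => (((hDl r).mul (hl1 r).continuousAt).sub hS).pow 2))) ?_
    simp only [hp₀, hev, hDa, PiLp.toLp_apply]
    rw [jackknife_variance_const_mul_looMean hR0 hR1 z c]
    exact (Real.sqrt_pos.2 hJpos).ne'
  have hσ : |(c / |c|)| = 1 := by rw [abs_div, abs_abs, div_self (abs_ne_zero.2 hc)]
  refine tendsto_measure_abs_le_of_perturbed_tStat hv hV hY hYm hΨm hσ hcont
    (Eventually.of_forall hval) ?_ hq
  filter_upwards [eventually_gt_atTop 0] with n hn ω
  have hs : 0 < Real.sqrt (n : ℝ) := Real.sqrt_pos.2 (by exact_mod_cast hn)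
  rw [hΨ]
  exact jackknife_studentised_eq_scaled hR0 hR1 φ (A n ω) a κ hs

/-- **`free_energy`'s `dF ± q·dF_err` (`κ = 0`)**: the delete-one-block jackknife bar around
`φ` OF THE POOLED MEAN has limiting coverage `L_R(q) = N(0,1)^{⊗R}{|t| ≤ q}` — the same Student-type
limit as the replica-`t` bar of a linear statistic (its value: GEN-24 S/B; `≤` and `→` the normal
coverage: T/F7).  For `φ = −log`, `a = Z₁/Z₀ > 0`, `c = −1/a ≠ 0`. -/
theorem tendsto_measure_abs_pooledJackknife_le_dF {A : ℕ → Ω₀ → ι → ℝ} (hA : ∀ n, Measurable (A n))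
    {a : ℝ} {φ : ℝ → ℝ} (hφm : Measurable φ) {c : ℝ} (hφ : HasDerivAt φ c a) (hc : c ≠ 0)
    {v : ℝ≥0} (hv : v ≠ 0)
    (hV : TendstoInDistribution
      (fun (n : ℕ) ω => toLp 2 (fun r => Real.sqrt (n : ℝ) * (A n ω r - a)))
      atTop (toLp 2) (fun _ => P) (Measure.pi fun _ : ι => gaussianReal 0 v))
    {q : ℝ} (hq : 0 ≤ q) :
    Tendsto (fun n => P {ω |
      |(φ ((∑ r, A n ω r) / Fintype.card ι) - φ a)
        / Real.sqrt (((Fintype.card ι : ℝ) - 1) / Fintype.card ι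
          * ∑ r, (φ ((∑ u ∈ univ.erase r, A n ω u) / ((Fintype.card ι : ℝ) - 1))
            - (∑ t, φ ((∑ u ∈ univ.erase t, A n ω u) / ((Fintype.card ι : ℝ) - 1)))
                / Fintype.card ι) ^ 2)| ≤ q}) atTop
      (𝓝 ((Measure.pi fun _ : ι => gaussianReal 0 1) {z : ι → ℝ | |(∑ r, z r) / Fintype.card ι
        / Real.sqrt ((∑ r, (z r - (∑ r', z r') / Fintype.card ι) ^ 2)
            / ((Fintype.card ι : ℝ) * (Fintype.card ι - 1)))| ≤ q})) := by
  refine (tendsto_measure_abs_pooledJackknife_le hA hφm hφ hc hv hV 0 hq).congr' ?_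
  refine Eventually.of_forall fun n => ?_
  simp only [zero_mul, add_zero]

end Main

end Summit.Ventures.LatticeQCDFlow.Exactness.GeneralNCMC
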